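import Literature.Probability.RandomPlanarGeometry.ChordalKSCondition
import Literature.Probability.RandomPlanarGeometry.KSRectangleExit
import HarnessLib

/-!
# Splitting the event `{curve ⊆ K}` at a first hitting time

Crux `AxiomsOfLimit` (stmt-CriticalPhenomena-1370), line `registered`, stub
`stub_rangeSubset_iff_stopAt_startFrom` (lead c5, wave 1). Theorems only.

A curve class `c` stays inside a set `K` iff both its *past* at the first hitting of a set `F`
(the initial segment `c.stopAt F`) and its *future* (the final segment `c.startFrom F`) stay
inside `K`. Indeed the trace of `c` is the union of the traces of the two pieces: a parameter
`t ≤ τ_F` is a parameter of the initial segment (`Curve.apply_mem_range_stopAt`), and a parameter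
`t ≥ τ_F` is the parameter `s = (t - τ_F) / (1 - τ_F)` of the final segment
(`RangeSplit.apply_mem_range_startFrom`). This splits the conditioning event `{γ ⊆ closure E}`
of the restriction property into a past event and a future event, as used by the
relative-restriction lemma for the Markov kernels.

References: W. Werner, *Lectures on two-dimensional critical percolation* (2007) §3.2;
G. F. Lawler, O. Schramm, W. Werner, *Conformal restriction: the chordal case* (2003) §3.
All [folklore].
-/

noncomputable section

open Set
open scoped unitInterval

namespace Summit.CriticalPhenomena.SAWScalingLimit.Theorems.AxiomsOfLimitKernelClause

open Literature.Probability.RandomPlanarGeometry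

namespace RangeSplit

/-- Every value `γ t` at a parameter `t ≥ hitParam F` is a point of the final segment
`γ.startFrom F`: it is its value at `s = (t - τ) / (1 - τ)` (`τ = hitParam F < 1`), and its
starting point if `τ = 1` (then `t = 1 = τ`). [folklore] -/
theorem apply_mem_range_startFrom {F : Set ℂ} {γ : Curve ℂ} {t : I}
    (ht : γ.hitParam F ≤ (t : ℝ)) : γ t ∈ (γ.startFrom F).range := by
  have hT := γ.hitParam_mem_Icc F
  -- a parameter `s ∈ [0, 1]` of the final segment with `τ + (1 - τ) s = t`
  obtain ⟨s, hs⟩ : ∃ s : I, γ.hitParam F + (1 - γ.hitParam F) * (s : ℝ) = t := by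
    rcases eq_or_lt_of_le hT.2 with hT1 | hT1
    · refine ⟨0, ?_⟩
      rw [Icc.coe_zero, mul_zero, add_zero]
      exact le_antisymm ht (t.2.2.trans_eq hT1.symm)
    · have h1T : 0 < 1 - γ.hitParam F := sub_pos.2 hT1
      refine ⟨⟨((t : ℝ) - γ.hitParam F) / (1 - γ.hitParam F),
        div_nonneg (sub_nonneg.2 ht) h1T.le, (div_le_one h1T).2 (by linarith [t.2.2])⟩, ?_⟩
      rw [Subtype.coe_mk, mul_div_cancel₀ _ h1T.ne']
      ring
  refine ⟨s, ?_⟩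
  show γ.startFrom F s = γ t
  rw [Curve.startFrom_apply, hs, projIcc_val]

/-- **The trace of a curve is covered by its past and its future at the first hitting of `F`**:
`range γ ⊆ range (γ.stopAt F) ∪ range (γ.startFrom F)` (split the parameter at `τ_F`).
[folklore] -/
theorem range_subset_union (F : Set ℂ) (γ : Curve ℂ) :
    γ.range ⊆ (γ.stopAt F).range ∪ (γ.startFrom F).range := by
  rintro _ ⟨t, rfl⟩
  rcases le_total (t : ℝ) (γ.hitParam F) with ht | ht
  · exact Or.inl (Curve.apply_mem_range_stopAt ht)
  · exact Or.inr (apply_mem_range_startFrom ht)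

/-- The same covering for curve classes (through the chosen representative `c.out`):
`range c ⊆ range (c.stopAt F) ∪ range (c.startFrom F)`. [folklore] -/
theorem curveClass_range_subset_union (F : Set ℂ) (c : CurveClass ℂ) :
    c.range ⊆ (c.stopAt F).range ∪ (c.startFrom F).range := by
  rw [CurveClass.stopAt, CurveClass.startFrom, CurveClass.range_mk, CurveClass.range_mk,
    ← CurveClass.range_out c]
  exact range_subset_union F c.out

/-- **The trace of a curve class is the union of the traces of its past and of its future** at
the first hitting of `F`. [folklore] -/
theorem curveClass_range_eq_union (F : Set ℂ) (c : CurveClass ℂ) :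
    c.range = (c.stopAt F).range ∪ (c.startFrom F).range :=
  (curveClass_range_subset_union F c).antisymm
    (union_subset (CurveClass.range_stopAt_subset F c) (CurveClass.range_startFrom_subset F c))

end RangeSplit

/-- **Splitting `{curve ⊆ K}` into a past event and a future event.** A curve class stays inside
`K` iff both its initial segment up to the first hitting of `F` and its final segment from there
stay inside `K` (the trace is the union of the two traces, `RangeSplit.curveClass_range_eq_union`).
[folklore] -/
theorem stub_rangeSubset_iff_stopAt_startFrom : ∀ (F K : Set ℂ) (c : Literature.Probability.RandomPlanarGeometry.CurveClass ℂ), c ∈ Literature.Probability.RandomPlanarGeometry.CurveClass.rangeSubset K ↔ c.stopAt F ∈ Literature.Probability.RandomPlanarGeometry.CurveClass.rangeSubset K ∧ c.startFrom F ∈ Literature.Probability.RandomPlanarGeometry.CurveClass.rangeSubset K := by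
  intro F K c
  simp only [CurveClass.mem_rangeSubset]
  exact ⟨fun h => ⟨(CurveClass.range_stopAt_subset F c).trans h,
      (CurveClass.range_startFrom_subset F c).trans h⟩,
    fun h => (RangeSplit.curveClass_range_subset_union F c).trans (union_subset h.1 h.2)⟩

end Summit.CriticalPhenomena.SAWScalingLimit.Theorems.AxiomsOfLimitKernelClause

end
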